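import Summits.CriticalPhenomena.PercolationContinuityZ3.Theorems.PercNearOneGluingNoHeavyLowerTailThreePointGamma
import HarnessLib

/-!
# `NoHeavyLowerTail` (stmt-CriticalPhenomena-4575) — the pivotal refinement, IV: the THREE-EVENT DICTIONARY
# (the coarse cells `q, u_a, u_b, u_c, T_a, T_b, T_c, T₀` are the atoms of the three increasing events "two terminals are joined avoiding the third")

Support file (prover prim-gen-kcluster gen 43; `--supports stmt-CriticalPhenomena-4575`).  No named facts, no sorries, no definitions.

With `pivEv a b c = {K | c ∉ cl (K ∖ touch{a}) b}` (prim-cert-2, `ThreePointGamma`) write `H_a := (pivEv a b c)ᶜ = {b ~ c off a}`,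
`H_b := (pivEv b a c)ᶜ = {a ~ c off b}`, `H_c := (pivEv c a b)ᶜ = {a ~ b off c}` (increasing events).  THEOREMS (set identities on
finite configurations, terminals pairwise distinct):
* `apart_eq` : `(conn a b)ᶜ ∩ (conn a c)ᶜ ∩ (conn b c)ᶜ = pivEv a b c ∩ pivEv b a c ∩ pivEv c a b`   (`q` = none of the three);
* `Ua_eq'`   : `conn b c ∩ (conn a b)ᶜ = (pivEv a b c)ᶜ ∩ pivEv b a c ∩ pivEv c a b`               (`u_a` = only `H_a`);
* `Ta_eq`    : `conn a b ∩ conn a c ∩ pivEv a b c = (pivEv b a c)ᶜ ∩ (pivEv c a b)ᶜ ∩ pivEv a b c` (`T_a` = `H_b ∧ H_c ∧ ¬H_a`);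
* `T0_eq`    : `conn a b ∩ conn a c ∩ (pivEv a b c)ᶜ ∩ (pivEv b a c)ᶜ ∩ (pivEv c a b)ᶜ = (pivEv a b c)ᶜ ∩ (pivEv b a c)ᶜ ∩ (pivEv c a b)ᶜ`
  (`T₀` = all three), and `joined_of_two` : any two of `H_a, H_b, H_c` give `abc`.
The key step (`avoid_of_conn_of_not_avoid`): if `a ~ b` but not off `c`, then `a ~ c` off `b` (a frontier pair of the cluster of `a` off `c` is a
pair at `c`, reached from `a` inside that cluster, which misses `b`).  So the eight T-side atoms of the doubly refined three-point law are the joint law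
of `(H_a, H_b, H_c)`; in the exploded graph (each terminal replaced by the leaf set of its pendant copies) these are the pairwise connections of the three
leaf sets.  KCLUSTER-gen43.md §1: under `H_v ↔ (G_v)ᶜ` (`G_v` = "the cluster of v meets every path between the other two") the refined rows R1/R2/R3/R4 of
the separating refinement become BHK/dR2/dR3/dR4 of the pivotal one (`PivotalBHK.bhkRow_PrW`, `dualRowR2_PrW`; dR3, dR4 conjectural).
-/

namespace Summit.CriticalPhenomena.PercolationContinuityZ3.Theorems

namespace PivotalBHK

open Finset Literature.Probability.Percolation Literature.Probability.Percolation.DecisionTree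
open Literature.Probability.Percolation.Gladkov ThreePointGamma ThreePointLB
open scoped Classical

variable {V : Type*} [Fintype V] [DecidableEq V] {a b c : V} {K : Finset (Sym2 V)}

/-- In a configuration with the pairs at `c` removed, `c` is reachable from `x` only if `x = c`. [folklore] -/
theorem mem_cl_sdiff_touch_self_iff {x : V} : c ∈ cl (K \ touch {c}) x ↔ x = c := by
  constructor
  · intro h
    by_contra hx
    obtain ⟨wlk⟩ := mem_cl.1 h
    have hC : ∀ u v, u ∈ (Finset.univ.filter fun v : V => v ≠ c) →
        (openGraph (↑(K \ touch {c}) : Set (Sym2 V))).Adj u v → v ∈ (Finset.univ.filter fun v : V => v ≠ c) := by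
      intro u v _ huv
      rw [Finset.mem_filter]
      refine ⟨Finset.mem_univ _, fun hvc => ?_⟩
      rw [adj_iff, Finset.mem_sdiff] at huv
      exact huv.1.2 (mk_mem_touch.2 (Or.inr (by rw [hvc]; exact Finset.mem_singleton_self c)))
    have := mem_of_walk hC wlk (by rw [Finset.mem_filter]; exact ⟨Finset.mem_univ _, hx⟩)
    rw [Finset.mem_filter] at this
    exact this.2 rfl
  · rintro rfl; exact mem_cl_self _ _

/-- **Frontier pair.** If `y` is in the cluster of `x` in `K` but not in the cluster `L` of `x` in `K'`, some pair of `K ∖ K'` leads out of `L`: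
there are `u ∈ L`, `v ∉ L` with `s(u, v) ∈ K`, `s(u, v) ∉ K'`, `u ≠ v`. [folklore] -/
theorem exists_frontier_pair {K' : Finset (Sym2 V)} {x y : V} (hy : y ∈ cl K x) (hy' : y ∉ cl K' x) :
    ∃ u v, u ∈ cl K' x ∧ v ∉ cl K' x ∧ s(u, v) ∈ K ∧ s(u, v) ∉ K' ∧ u ≠ v := by
  by_contra h
  push Not at h
  have hC : ∀ u v, u ∈ cl K' x → (openGraph (↑K : Set (Sym2 V))).Adj u v → v ∈ cl K' x := by
    intro u v hu huv
    rw [adj_iff] at huv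
    by_contra hv
    by_cases he : s(u, v) ∈ K'
    · exact hv (mem_cl_of_adj hu (adj_iff.2 ⟨he, huv.2⟩))
    · exact huv.2 (h u v hu hv huv.1 he)
  obtain ⟨wlk⟩ := mem_cl.1 hy
  exact hy' (mem_of_walk hC wlk (mem_cl_self K' x))

/-- **Key step of the dictionary**: if `a ~ b` in `K` but NOT avoiding `c` (every `a–b` path uses `c`), then `a ~ c` avoiding `b` (`a ≠ c`). [this work] -/
theorem avoid_of_conn_of_not_avoid (hac : a ≠ c) (hbc : b ≠ c) (hab : b ∈ cl K a) (hnot : b ∉ cl (K \ touch {c}) a) :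
    c ∈ cl (K \ touch {b}) a := by
  obtain ⟨u, v, hu, _hv, huvK', huvK'', huv'⟩ := exists_frontier_pair (K' := K \ touch {c}) hab hnot
  -- the frontier pair is a pair at `c`, and `u ≠ c` (the cluster off `c` misses `c`), so `v = c`
  have hvc : v = c := by
    have h1 : s(u, v) ∈ touch {c} := by
      by_contra h2; exact huvK'' (Finset.mem_sdiff.2 ⟨huvK', h2⟩)
    rcases mk_mem_touch.1 h1 with h | h
    · rw [Finset.mem_singleton] at h
      rw [h] at hu
      exact absurd (mem_cl_sdiff_touch_self_iff.1 hu) hac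
    · exact Finset.mem_singleton.1 h
  have huvK : s(u, c) ∈ K := by rw [← hvc]; exact huvK'
  have huv : u ≠ c := by rw [← hvc]; exact huv'
  -- the cluster `L` of `a` off `c` misses `b`; its pairs and the pair `s(u, c)` avoid `b`
  have hLb : ∀ z ∈ cl (K \ touch {c}) a, z ≠ b := fun z hz hzb => hnot (hzb ▸ hz)
  have hsub : cl (K \ touch {c}) a ⊆ cl (K \ touch {b}) a := by
    intro z hz
    obtain ⟨wlk⟩ := mem_cl.1 hz
    refine mem_cl.2 (reachable_of_walk (C := cl (K \ touch {c}) a) (fun y y' hy hyy' => mem_cl_of_adj hy hyy') ?_ wlk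
      (mem_cl_self _ a))
    intro y y' hy hyy'
    have hy'mem : y' ∈ cl (K \ touch {c}) a := mem_cl_of_adj hy hyy'
    rw [adj_iff] at hyy' ⊢
    refine ⟨Finset.mem_sdiff.2 ⟨(Finset.mem_sdiff.1 hyy'.1).1, fun ht => ?_⟩, hyy'.2⟩
    rcases mk_mem_touch.1 ht with h | h
    · exact hLb y hy (Finset.mem_singleton.1 h)
    · exact hLb y' hy'mem (Finset.mem_singleton.1 h)
  have hu' : u ∈ cl (K \ touch {b}) a := hsub hu
  refine mem_cl_of_adj hu' (adj_iff.2 ⟨Finset.mem_sdiff.2 ⟨huvK, fun ht => ?_⟩, huv⟩)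
  rcases mk_mem_touch.1 ht with h | h
  · exact hLb u hu (Finset.mem_singleton.1 h)
  · exact hbc (Finset.mem_singleton.1 h).symm

/-- Monotonicity: a connection avoiding a vertex is a connection. [folklore] -/
theorem mem_cl_of_mem_cl_sdiff {x y z : V} (h : y ∈ cl (K \ touch {z}) x) : y ∈ cl K x := cl_mono Finset.sdiff_subset x h

/-- **Any two of the three avoiding-connections give `abc`**: `a ~ c` off `b` and `b ~ c` off `a` imply `a ~ b` (and `a ~ c`). [this work] -/
theorem conn_of_two_avoid (h1 : K ∉ pivEv b a c) (h2 : K ∉ pivEv a b c) : K ∈ conn a b ∩ conn a c := by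
  rw [mem_pivEv, not_not] at h1 h2
  have hac : c ∈ cl K a := mem_cl_of_mem_cl_sdiff h1
  have hbc : c ∈ cl K b := mem_cl_of_mem_cl_sdiff h2
  exact ⟨mem_conn_iff_mem_cl.2 (mem_cl.2 ((mem_cl.1 hac).trans (mem_cl.1 hbc).symm)), mem_conn_iff_mem_cl.2 hac⟩

/-- **`q` = none of the three**: the terminals are pairwise apart iff no two of them are joined avoiding the third (`a ≠ b`, `a ≠ c`, `b ≠ c`). [this work] -/
theorem apart_eq (hab : a ≠ b) (hac : a ≠ c) (hbc : b ≠ c) :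
    ((conn a b)ᶜ ∩ (conn a c)ᶜ ∩ (conn b c)ᶜ : Set (Finset (Sym2 V))) = pivEv a b c ∩ pivEv b a c ∩ pivEv c a b := by
  ext K
  simp only [Set.mem_inter_iff, Set.mem_compl_iff, mem_pivEv, mem_conn_iff_mem_cl]
  constructor
  · rintro ⟨⟨h1, h2⟩, h3⟩
    exact ⟨⟨fun h => h3 (mem_cl_of_mem_cl_sdiff h), fun h => h2 (mem_cl_of_mem_cl_sdiff h)⟩, fun h => h1 (mem_cl_of_mem_cl_sdiff h)⟩
  · rintro ⟨⟨h1, h2⟩, h3⟩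
    -- if a ~ b then, as it is not off c (h3), a ~ c off b: contradiction with h2; similarly for the others
    have hab' : b ∉ cl K a := fun h => h2 (avoid_of_conn_of_not_avoid hac hbc h h3)
    have hac' : c ∉ cl K a := fun h => h3 (avoid_of_conn_of_not_avoid hab hbc.symm h h2)
    refine ⟨⟨hab', hac'⟩, fun h => ?_⟩
    -- b ~ c: not off a (h1), so b ~ a off c, hence a ~ b: contradiction
    have := avoid_of_conn_of_not_avoid hab.symm hac.symm h h1
    exact hab' (mem_cl_comm.1 (mem_cl_of_mem_cl_sdiff this))

/-- **`u_a` = only `H_a`**: `bc|a` iff `b ~ c` off `a` and neither `a ~ c` off `b` nor `a ~ b` off `c`. [this work] -/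
theorem Ua_eq' (hab : a ≠ b) (hac : a ≠ c) (hbc : b ≠ c) :
    (conn b c ∩ (conn a b)ᶜ : Set (Finset (Sym2 V))) = (pivEv a b c)ᶜ ∩ pivEv b a c ∩ pivEv c a b := by
  ext K
  simp only [Set.mem_inter_iff, Set.mem_compl_iff, mem_pivEv, mem_conn_iff_mem_cl, not_not]
  constructor
  · rintro ⟨hbc, hab'⟩
    have hba : b ∉ cl K a := hab'
    refine ⟨⟨?_, fun h => hba ?_⟩, fun h => hba (mem_cl_of_mem_cl_sdiff h)⟩
    · -- b ~ c; if not off a then b ~ a off c, so a ~ b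
      by_contra hn
      have := avoid_of_conn_of_not_avoid hab.symm hac.symm hbc hn
      exact hba (mem_cl_comm.1 (mem_cl_of_mem_cl_sdiff this))
    · -- a ~ c off b and c ~ b give a ~ b
      have hac' : c ∈ cl K a := mem_cl_of_mem_cl_sdiff h
      exact mem_cl.2 ((mem_cl.1 hac').trans (mem_cl.1 hbc).symm)
  · rintro ⟨⟨h1, h2⟩, h3⟩
    refine ⟨mem_cl_of_mem_cl_sdiff h1, fun h => ?_⟩
    -- a ~ b: if off c, contradiction with h3; else a ~ c off b, contradiction with h2
    exact h2 (avoid_of_conn_of_not_avoid hac hbc h h3)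

/-- **`T_a` = `H_b ∧ H_c ∧ ¬H_a`**: `abc` with `a` pivotal iff `a ~ c` off `b`, `a ~ b` off `c`, and not `b ~ c` off `a`. [this work] -/
theorem Ta_eq (hab : a ≠ b) (hac : a ≠ c) (hbc : b ≠ c) :
    (conn a b ∩ conn a c ∩ pivEv a b c : Set (Finset (Sym2 V))) = (pivEv b a c)ᶜ ∩ (pivEv c a b)ᶜ ∩ pivEv a b c := by
  ext K
  simp only [Set.mem_inter_iff, Set.mem_compl_iff, mem_pivEv, mem_conn_iff_mem_cl, not_not]
  constructor
  · rintro ⟨⟨h1, h2⟩, h3⟩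
    refine ⟨⟨?_, ?_⟩, h3⟩
    · -- a ~ c; if it were not off b then (key step at (c; a, b)) c ~ b off a, contradicting that a is pivotal (h3)
      by_contra hn
      have hca : a ∈ cl K c := mem_cl_comm.1 h2
      have hn' : a ∉ cl (K \ touch {b}) c := fun h => hn (mem_cl_comm.1 h)
      have := avoid_of_conn_of_not_avoid hbc.symm hab hca hn'
      exact h3 (mem_cl_comm.1 this)
    · by_contra hn
      have hba : a ∈ cl K b := mem_cl_comm.1 h1
      have hn' : a ∉ cl (K \ touch {c}) b := fun h => hn (mem_cl_comm.1 h)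
      have := avoid_of_conn_of_not_avoid hbc hac hba hn'
      exact h3 this
  · rintro ⟨⟨h1, h2⟩, h3⟩
    exact ⟨⟨mem_cl_of_mem_cl_sdiff h2, mem_cl_of_mem_cl_sdiff h1⟩, h3⟩

/-- **`T₀` = all three**: `abc` with no terminal pivotal iff all three avoiding-connections hold. [this work] -/
theorem T0_eq :
    (conn a b ∩ conn a c ∩ ((pivEv a b c)ᶜ ∩ (pivEv b a c)ᶜ ∩ (pivEv c a b)ᶜ) : Set (Finset (Sym2 V))) =
      (pivEv a b c)ᶜ ∩ (pivEv b a c)ᶜ ∩ (pivEv c a b)ᶜ := by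
  ext K
  simp only [Set.mem_inter_iff, Set.mem_compl_iff]
  constructor
  · rintro ⟨-, h⟩; exact h
  · rintro ⟨⟨h1, h2⟩, h3⟩
    exact ⟨conn_of_two_avoid h2 h1, ⟨h1, h2⟩, h3⟩

end PivotalBHK

end Summit.CriticalPhenomena.PercolationContinuityZ3.Theorems
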